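import Summits.Parity.GeneralizedHardyLittlewood.Theorems.PrimeLevelFamEdgeMomentsBeyondDiagonalDiagRemP2MoebiusSplit
import Summits.Parity.GeneralizedHardyLittlewood.Theorems.PrimeLevelFamEdgeMomentsBeyondDiagonalDiagRemP2MertensLogSq
import Summits.Parity.GeneralizedHardyLittlewood.Theorems.PrimeLevelFamEdgeMomentsBeyondDiagonalDiagRemP2RieszTwo
import Summits.Parity.GeneralizedHardyLittlewood.Theorems.BeyondDiagonalBeatsQuarter.KernelFormXSqTools
import Literature.NumberTheory.Sieve.GoldstonYildirimLemma21
import Literature.NumberTheory.LFunctions.SelbergPrimeSumEstimates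
import Mathlib.NumberTheory.Harmonic.Bounds
import HarnessLib

/-!
# Route `PrimeLevelFamEdge`, crux K_A `MomentsBeyondDiagonal` (stmt-Parity-20007), line «petersson_layers» v4, stub `stub_diag`:
# **`Σ_{d ≤ y} μ(d)P₂(d)/d = −log y − ρ/2 + O((log y)⁻ⁿ)`** (L3 of the (P2TAIL) chain, analytic half)

`P₂(d) = Σ_{p ∣ d} log²p`; `ρ` is the constant of the second logarithmic Riesz mean `R₂(y) = Σ_{n ≤ y} μ(n)log²(y/n)/n =
2 log y + ρ + O(e^{−c√log y})` (`…DiagRemP2RieszTwo.exists_abs_moebiusLogSqSum_sub_sub_const_le`). Assembly of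
`…DiagRemP2MoebiusSplit.sum_moebius_primeSq_div_split` (exact splitting at `√y`) with

* the small primes `p ≤ √y`: the tree's Goldston–Yıldırım bound `|Σ_{m ≤ R, (m,p)=1} μ(m)/m| ≤ C e^{−c√log R}` for `p ≤ R`
  (`…GoldstonYildirimLemma21.goldstonYildirim_lemma21_j0_holds`, `R = y/p ≥ √y`) and `Σ_{p ≤ √y} log²p/p ≤ log√y(log√y+2)`
  (`…SelbergPrimes.sum_log_sq_div_le`);
* the large primes: `S(x) = Σ_{p ≤ x}log²p/p = ½log²x + κ + O((log x)⁻ⁿ⁻¹)` (`…DiagRemP2MertensLogSq.abs_primeLogSqDivSum_sub_le`),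
  then `Σ_{k ≤ √y} μ(k)log²(y/k)/k = ¼log²y·m(√y) + log y·M₁(√y) + R₂(√y)` with the tree's `M₁ → 1`
  (`…GreenTao2008.exists_abs_moebiusLogSum_sub_one_le`), `|m| ≤ C` and the `R₂` constant.

* `sum_Icc_inv_le_one_add_log'` — `Σ_{k ≤ J} 1/k ≤ 1 + log J`;
* `sum_moebius_primeSq_div_asymp_of` — **`∃ c_F, ∀ n, ∃ K, ∀ y ≥ 4: |Σ_{d ≤ y} μ(d)P₂(d)/d + log y − c_F| ≤ K/(log y)ⁿ`**
  (`c_F = −ρ/2`), stated FROM the Goldston–Yıldırım fact `goldstonYildirim_lemma21_j0` as a hypothesis (it is PROVED in the tree,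
  `…GoldstonYildirimLemma21MoebiusSumProofs.goldstonYildirim_lemma21_j0_holds`; the unconditional corollary is the 3-line file
  `…DiagRemP2MoebiusAsympHolds`, kept separate only because that proofs module is outside this file's build closure).

Def-free; theorems only; classical (a by-product of Selberg's formula bookkeeping, Hardy–Wright §22.15, with the
prime-number-theorem rate). Helper `--supports stmt-Parity-20007`; closes nothing; K_A, K_B and the Parity summit are NOT proved;
nothing about Landau–Siegel zeros.

## References
* G. H. Hardy, E. M. Wright, *An Introduction to the Theory of Numbers*, 6th ed., §22.15–§22.16.
  [cite: HardyWright2008, §22.15 — derivation (with the de la Vallée-Poussin rate)]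
* D. A. Goldston, C. Y. Yıldırım, Integers 3 (2003) A5, Lemma 2.1 (2.13). [cite: GoldstonYildirim2001, Lemma 2.1 (2.13)]
-/

noncomputable section

open Finset Real
open scoped ArithmeticFunction.Moebius

namespace Summit.Parity.GeneralizedHardyLittlewood.Theorems.MomentsBeyondDiagonal.DiagCorner

open Literature.NumberTheory.Sieve (goldstonYildirim_lemma21_j0)
open Literature.NumberTheory.Sieve.GreenTao2008
open Literature.NumberTheory.LFunctions.MoebiusLogSum
open Literature.NumberTheory.LFunctions.SelbergPrimes (sum_log_sq_div_le)
open Summit.Parity.GeneralizedHardyLittlewood.Theorems.BeyondDiagonalBeatsQuarter.KernelFormXSq (exp_neg_sqrt_le_div_pow)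

/-- `Σ_{k=1}^{J} 1/k ≤ 1 + log J` (`J ≥ 1`), from Mathlib's `harmonic_le_one_add_log`. [folklore] -/
theorem sum_Icc_inv_le_one_add_log' {J : ℕ} (hJ : 1 ≤ J) :
    ∑ k ∈ Icc 1 J, (k : ℝ)⁻¹ ≤ 1 + Real.log J := by
  have h := harmonic_le_one_add_log J
  have h2 : ((harmonic J : ℚ) : ℝ) = ∑ k ∈ Icc 1 J, (k : ℝ)⁻¹ := by
    rw [harmonic_eq_sum_Icc]
    push_cast
    rfl
  rw [h2] at h
  have _ := hJ
  exact h

/-- `e^{−c√(L/2)} ≤ K/Lᵏ` for `L ≥ 1`. [folklore] -/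
theorem exp_neg_sqrt_half_le_div_pow {c : ℝ} (hc : 0 < c) (k : ℕ) :
    ∃ K : ℝ, 0 < K ∧ ∀ L : ℝ, 1 ≤ L → Real.exp (-(c * Real.sqrt (L / 2))) ≤ K / L ^ k := by
  obtain ⟨K₀, hK₀, h⟩ := exp_neg_sqrt_le_div_pow hc k
  refine ⟨K₀ * 2 ^ k, by positivity, fun L hL ↦ ?_⟩
  have hL0 : 0 < L := by linarith
  refine (h (L / 2) (by positivity)).trans ?_
  rw [div_le_div_iff₀ (by positivity) (by positivity)]
  have : L ≤ (1 + L / 2) * 2 := by linarith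
  calc K₀ * L ^ k ≤ K₀ * ((1 + L / 2) * 2) ^ k := by gcongr
    _ = K₀ * 2 ^ k * (1 + L / 2) ^ k := by rw [mul_pow]; ring

set_option maxHeartbeats 800000 in
/-- **`Σ_{d ≤ y} μ(d)P₂(d)/d = −log y + c_F + O((log y)⁻ⁿ)`** (from the Goldston–Yıldırım bound `goldstonYildirim_lemma21_j0`,
proved in the tree): there is `c_F` (`= −ρ/2`, `ρ` the constant of `R₂`) such that for every `n` there is `K` with
`|Σ_{d ≤ y} μ(d)/d·Σ_{p∣d}log²p + log y − c_F| ≤ K/(log y)ⁿ` for all `y ≥ 4`.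
[cite: HardyWright2008, §22.15 — derivation (with the de la Vallée-Poussin rate)] -/
theorem sum_moebius_primeSq_div_asymp_of (hGY : goldstonYildirim_lemma21_j0) :
    ∃ cF : ℝ, ∀ n : ℕ, ∃ K : ℝ, ∀ y : ℝ, 4 ≤ y →
    |(∑ d ∈ Icc 1 ⌊y⌋₊, (ArithmeticFunction.moebius d : ℝ) / d * ∑ p ∈ d.primeFactors, Real.log p ^ 2) +
        Real.log y - cF| ≤ K / Real.log y ^ n := by
  obtain ⟨ρ, cρ, hcρ, Cρ, hCρ0, hρ⟩ := exists_abs_moebiusLogSqSum_sub_sub_const_le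
  refine ⟨-(ρ / 2), fun n ↦ ?_⟩
  -- the inputs
  obtain ⟨cG, hcG, hG⟩ := hGY
  obtain ⟨CG, hCG⟩ := hG 1 one_pos
  obtain ⟨c₁, hc₁, C₁, hC₁0, hM₁⟩ := exists_abs_moebiusLogSum_sub_one_le
  obtain ⟨c₀, hc₀, C₀, hC₀0, hm⟩ := exists_abs_moebiusHarmonic_le
  obtain ⟨K₂, hK₂⟩ := abs_primeLogSqDivSum_sub_le (n + 1)
  obtain ⟨EG, hEG0, hEG⟩ := exp_neg_sqrt_half_le_div_pow hcG (n + 2)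
  obtain ⟨E₁, hE₁0, hE₁⟩ := exp_neg_sqrt_half_le_div_pow hc₁ (n + 1)
  obtain ⟨Eρ, hEρ0, hEρ⟩ := exp_neg_sqrt_half_le_div_pow hcρ n
  -- nonnegativity of the constants that are not given nonnegative
  have hCG0 : 0 ≤ CG := by
    have h := hCG 1 le_rfl 1 le_rfl (by norm_num)
    have h0 : (0 : ℝ) ≤ CG * Real.exp (-cG * Real.sqrt (Real.log 1)) := (abs_nonneg _).trans h
    by_contra hneg
    have : CG * Real.exp (-cG * Real.sqrt (Real.log 1)) < 0 :=
      mul_neg_of_neg_of_pos (not_le.mp hneg) (Real.exp_pos _)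
    linarith
  have hK₂0 : 0 ≤ K₂ := by
    have h := hK₂ 2 le_rfl
    have hl2 : 0 < Real.log 2 := Real.log_pos one_lt_two
    have h0 : 0 ≤ K₂ / Real.log 2 ^ (n + 1) := (abs_nonneg _).trans h
    by_contra hneg
    have : K₂ / Real.log 2 ^ (n + 1) < 0 := div_neg_of_neg_of_pos (not_le.mp hneg) (pow_pos hl2 _)
    linarith
  refine ⟨2 * CG * EG + 2 ^ (n + 4) * K₂ + C₁ * E₁ + Cρ * Eρ, fun y hy ↦ ?_⟩
  -- the parameters
  have hy0 : 0 < y := by linarith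
  have hy1 : 1 ≤ y := by linarith
  set L : ℝ := Real.log y with hLdef
  have hL4 : Real.log 4 ≤ L := Real.log_le_log (by norm_num) hy
  have hlog4 : 1 < Real.log 4 := by
    have h2 : Real.log 4 = 2 * Real.log 2 := by
      rw [show (4 : ℝ) = 2 ^ 2 by norm_num, Real.log_pow]; norm_num
    have := Real.log_two_gt_d9; linarith
  have hL1 : 1 ≤ L := by linarith
  have hL0 : 0 < L := by linarith
  set u : ℝ := Real.sqrt y with hudef
  have hu2 : 2 ≤ u := by
    rw [hudef, show (2 : ℝ) = Real.sqrt 4 by rw [show (4:ℝ) = 2 ^ 2 by norm_num, Real.sqrt_sq (by norm_num)]]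
    exact Real.sqrt_le_sqrt hy
  have hu0 : 0 < u := by linarith
  have hu1 : 1 ≤ u := by linarith
  have huu : u * u = y := Real.mul_self_sqrt hy0.le
  have hlogu : Real.log u = L / 2 := by
    rw [hudef, Real.log_sqrt hy0.le]
  set N : ℕ := ⌊y⌋₊ with hNdef
  set J : ℕ := ⌊u⌋₊ with hJdef
  have hJu : (J : ℝ) ≤ u := Nat.floor_le hu0.le
  have huJ : u < (J : ℝ) + 1 := Nat.lt_floor_add_one u
  have hJ2 : 2 ≤ J := Nat.le_floor (by simpa using hu2)
  have hJ1 : 1 ≤ J := by omega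
  have hJ0 : (0 : ℝ) < J := by exact_mod_cast (by omega : 0 < J)
  have hJJ : J * J ≤ N := by
    refine Nat.le_floor ?_
    push_cast
    calc (J : ℝ) * J ≤ u * u := mul_le_mul hJu hJu hJ0.le hu0.le
      _ = y := huu
  have hNJ : N < (J + 1) * (J + 1) := by
    refine (Nat.floor_lt hy0.le).2 ?_
    push_cast
    calc y = u * u := huu.symm
      _ < ((J : ℝ) + 1) * ((J : ℝ) + 1) := mul_lt_mul'' huJ huJ hu0.le hu0.le
  have hlogJ : Real.log J ≤ L / 2 := by rw [← hlogu]; exact Real.log_le_log hJ0 hJu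
  -- exponential inputs at `L/2`
  have hexp : ∀ {c x : ℝ}, 0 < c → u ≤ x → Real.exp (-(c * Real.sqrt (Real.log x))) ≤ Real.exp (-(c * Real.sqrt (L / 2))) := by
    intro c x hc hx
    apply Real.exp_le_exp.2
    have : Real.sqrt (L / 2) ≤ Real.sqrt (Real.log x) := by
      rw [← hlogu]; exact Real.sqrt_le_sqrt (Real.log_le_log hu0 hx)
    nlinarith
  -- the split
  rw [sum_moebius_primeSq_div_split hJJ hNJ]
  ------------------------------------------------------------------
  -- Term A: the small primes
  ------------------------------------------------------------------
  have hA : |∑ p ∈ Nat.primesLE J, Real.log p ^ 2 / p *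
      ∑ m ∈ (Icc 1 (N / p)).filter (fun m ↦ m.Coprime p), (ArithmeticFunction.moebius m : ℝ) / m| ≤
      2 * CG * EG / L ^ n := by
    have hterm : ∀ p ∈ Nat.primesLE J, |Real.log p ^ 2 / p *
        ∑ m ∈ (Icc 1 (N / p)).filter (fun m ↦ m.Coprime p), (ArithmeticFunction.moebius m : ℝ) / m| ≤
        Real.log p ^ 2 / p * (CG * Real.exp (-(cG * Real.sqrt (L / 2)))) := by
      intro p hp
      obtain ⟨hpJ, hpp⟩ := Nat.mem_primesLE.1 hp
      have hp0 : (0 : ℝ) < p := by exact_mod_cast hpp.pos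
      have hp1 : 1 ≤ p := hpp.one_lt.le
      have hpu : (p : ℝ) ≤ u := le_trans (by exact_mod_cast hpJ) hJu
      -- `R = y/p ≥ u ≥ 2`, `p ≤ R`
      have hR : u ≤ y / p := by
        rw [le_div_iff₀ hp0, ← huu]
        exact mul_le_mul_of_nonneg_left hpu hu0.le
      have hR1 : 1 ≤ y / p := hu1.trans hR
      have hpR : (p : ℝ) ≤ (y / p) ^ (1 : ℝ) := by rw [Real.rpow_one]; exact hpu.trans hR
      have hfloor : ⌊y / p⌋₊ = N / p := by rw [hNdef]; exact Nat.floor_div_natCast y p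
      have hg := hCG p hp1 (y / p) hR1 hpR
      rw [hfloor, neg_mul] at hg
      rw [abs_mul, abs_of_nonneg (by positivity : (0 : ℝ) ≤ Real.log p ^ 2 / p)]
      refine mul_le_mul_of_nonneg_left (hg.trans ?_) (by positivity)
      exact mul_le_mul_of_nonneg_left (hexp hcG hR) hCG0
    have hS : ∑ p ∈ Nat.primesLE J, Real.log p ^ 2 / p ≤ Real.log u * (Real.log u + 2) := by
      have := sum_log_sq_div_le hu1
      rwa [← hJdef] at this
    have hS' : Real.log u * (Real.log u + 2) ≤ 2 * L ^ 2 := by rw [hlogu]; nlinarith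
    calc _ ≤ ∑ p ∈ Nat.primesLE J, Real.log p ^ 2 / p * (CG * Real.exp (-(cG * Real.sqrt (L / 2)))) :=
          (Finset.abs_sum_le_sum_abs _ _).trans (Finset.sum_le_sum hterm)
      _ = (∑ p ∈ Nat.primesLE J, Real.log p ^ 2 / p) * (CG * Real.exp (-(cG * Real.sqrt (L / 2)))) := by
          rw [Finset.sum_mul]
      _ ≤ (2 * L ^ 2) * (CG * (EG / L ^ (n + 2))) := by
          have h1 : 0 ≤ CG * Real.exp (-(cG * Real.sqrt (L / 2))) := by positivity
          have h2 : 0 ≤ ∑ p ∈ Nat.primesLE J, Real.log p ^ 2 / p :=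
            Finset.sum_nonneg fun p _ ↦ by positivity
          exact mul_le_mul (hS.trans hS') (mul_le_mul_of_nonneg_left (hEG L hL1) hCG0) h1 (by positivity)
      _ = 2 * CG * EG / L ^ n := by rw [pow_add]; field_simp
  ------------------------------------------------------------------
  -- Term B: the large primes
  ------------------------------------------------------------------
  -- `S` at `y/k` and at `u`
  have hSk : ∀ k ∈ Icc 1 J, |(∑ p ∈ Nat.primesLE (N / k), Real.log p ^ 2 / p) -
      (∑ p ∈ Nat.primesLE J, Real.log p ^ 2 / p) - (Real.log (y / k) ^ 2 / 2 - Real.log u ^ 2 / 2)| ≤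
      2 ^ (n + 2) * K₂ / L ^ (n + 1) := by
    intro k hk
    have hk1 : 1 ≤ k := (Finset.mem_Icc.1 hk).1
    have hkJ : k ≤ J := (Finset.mem_Icc.1 hk).2
    have hk0 : (0 : ℝ) < k := by exact_mod_cast hk1
    have hku : (k : ℝ) ≤ u := le_trans (by exact_mod_cast hkJ) hJu
    have hyk : u ≤ y / k := by
      rw [le_div_iff₀ hk0, ← huu]
      exact mul_le_mul_of_nonneg_left hku hu0.le
    have hyk2 : 2 ≤ y / k := hu2.trans hyk
    have hfloor : ⌊y / k⌋₊ = N / k := by rw [hNdef]; exact Nat.floor_div_natCast y k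
    have h1 := hK₂ (y / k) hyk2
    have h2 := hK₂ u hu2
    rw [hfloor] at h1
    rw [← hJdef] at h2
    -- `(log x)^{-(n+1)} ≤ (L/2)^{-(n+1)}` for `x ≥ u`
    have hpow : ∀ {x : ℝ}, u ≤ x → K₂ / Real.log x ^ (n + 1) ≤ 2 ^ (n + 1) * K₂ / L ^ (n + 1) := by
      intro x hx
      have hlx : L / 2 ≤ Real.log x := by rw [← hlogu]; exact Real.log_le_log hu0 hx
      have hL2 : 0 < L / 2 := by positivity
      calc K₂ / Real.log x ^ (n + 1) ≤ K₂ / (L / 2) ^ (n + 1) := by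
            apply div_le_div_of_nonneg_left hK₂0 (pow_pos hL2 _)
            exact pow_le_pow_left₀ hL2.le hlx _
        _ = 2 ^ (n + 1) * K₂ / L ^ (n + 1) := by
            rw [div_pow]; field_simp
    have e1 := h1.trans (hpow hyk)
    have e2 := h2.trans (hpow le_rfl)
    have h22 : (2 : ℝ) ^ (n + 2) * K₂ / L ^ (n + 1) = 2 * (2 ^ (n + 1) * K₂ / L ^ (n + 1)) := by ring
    rw [h22]
    rw [abs_le] at e1 e2 ⊢
    constructor <;> linarith [e1.1, e1.2, e2.1, e2.2]
  -- the main part of Term B: `Σ μ(k)/k·(½log²(y/k) − ½log²u) = ½ L·M₁(u) + ½ R₂(u) − … ` exactly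
  have hmainB : ∑ k ∈ Icc 1 J, (ArithmeticFunction.moebius k : ℝ) / k *
      (Real.log (y / k) ^ 2 / 2 - Real.log u ^ 2 / 2) =
      L / 2 * moebiusLogSum u + moebiusLogSqSum u / 2 := by
    rw [moebiusLogSum_def, moebiusLogSqSum_def, ← hJdef, Finset.mul_sum, Finset.sum_div, ← Finset.sum_add_distrib]
    refine Finset.sum_congr rfl fun k hk ↦ ?_
    have hk0 : (0 : ℝ) < k := by exact_mod_cast (Finset.mem_Icc.1 hk).1
    have hlyk : Real.log (y / k) = L - Real.log k := by rw [Real.log_div hy0.ne' hk0.ne']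
    have hluk : Real.log (u / k) = L / 2 - Real.log k := by rw [Real.log_div hu0.ne' hk0.ne', hlogu]
    rw [hlyk, hluk, hlogu]
    ring
  have hM₁u := hM₁ u hu2
  have hρu := hρ u hu2
  rw [hlogu] at hρu
  -- Term B error part
  have hBerr : |∑ k ∈ Icc 1 J, (ArithmeticFunction.moebius k : ℝ) / k *
      ((∑ p ∈ Nat.primesLE (N / k), Real.log p ^ 2 / p) - (∑ p ∈ Nat.primesLE J, Real.log p ^ 2 / p) -
        (Real.log (y / k) ^ 2 / 2 - Real.log u ^ 2 / 2))| ≤ 2 ^ (n + 4) * K₂ / L ^ n := by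
    have hterm : ∀ k ∈ Icc 1 J, |(ArithmeticFunction.moebius k : ℝ) / k *
        ((∑ p ∈ Nat.primesLE (N / k), Real.log p ^ 2 / p) - (∑ p ∈ Nat.primesLE J, Real.log p ^ 2 / p) -
          (Real.log (y / k) ^ 2 / 2 - Real.log u ^ 2 / 2))| ≤ (k : ℝ)⁻¹ * (2 ^ (n + 2) * K₂ / L ^ (n + 1)) := by
      intro k hk
      have hk0 : (0 : ℝ) < k := by exact_mod_cast (Finset.mem_Icc.1 hk).1
      rw [abs_mul]
      refine mul_le_mul ?_ (hSk k hk) (abs_nonneg _) (by positivity)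
      rw [abs_div, abs_of_pos hk0, div_le_iff₀ hk0, inv_mul_cancel₀ hk0.ne']
      exact_mod_cast ArithmeticFunction.abs_moebius_le_one
    have hharm := sum_Icc_inv_le_one_add_log' hJ1
    calc _ ≤ ∑ k ∈ Icc 1 J, (k : ℝ)⁻¹ * (2 ^ (n + 2) * K₂ / L ^ (n + 1)) :=
          (Finset.abs_sum_le_sum_abs _ _).trans (Finset.sum_le_sum hterm)
      _ = (∑ k ∈ Icc 1 J, (k : ℝ)⁻¹) * (2 ^ (n + 2) * K₂ / L ^ (n + 1)) := by rw [Finset.sum_mul]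
      _ ≤ (1 + Real.log J) * (2 ^ (n + 2) * K₂ / L ^ (n + 1)) :=
          mul_le_mul_of_nonneg_right hharm (by positivity)
      _ ≤ (2 * L) * (2 ^ (n + 2) * K₂ / L ^ (n + 1)) := by
          have : 1 + Real.log J ≤ 2 * L := by linarith
          exact mul_le_mul_of_nonneg_right this (by positivity)
      _ = 2 ^ (n + 3) * K₂ / L ^ n := by rw [pow_succ L n]; field_simp; ring
      _ ≤ 2 ^ (n + 4) * K₂ / L ^ n := by
          apply div_le_div_of_nonneg_right _ (by positivity)
          have : (2 : ℝ) ^ (n + 3) ≤ 2 ^ (n + 4) := pow_le_pow_right₀ (by norm_num) (by omega)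
          nlinarith
  -- Term B decomposition
  have hBsplit : ∑ k ∈ Icc 1 J, (ArithmeticFunction.moebius k : ℝ) / k *
      ((∑ p ∈ Nat.primesLE (N / k), Real.log p ^ 2 / p) - ∑ p ∈ Nat.primesLE J, Real.log p ^ 2 / p) =
      (L / 2 * moebiusLogSum u + moebiusLogSqSum u / 2) +
      ∑ k ∈ Icc 1 J, (ArithmeticFunction.moebius k : ℝ) / k *
        ((∑ p ∈ Nat.primesLE (N / k), Real.log p ^ 2 / p) - (∑ p ∈ Nat.primesLE J, Real.log p ^ 2 / p) -
          (Real.log (y / k) ^ 2 / 2 - Real.log u ^ 2 / 2)) := by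
    rw [← hmainB, ← Finset.sum_add_distrib]
    refine Finset.sum_congr rfl fun k _ ↦ ?_
    ring
  rw [hBsplit]
  ------------------------------------------------------------------
  -- assembly
  ------------------------------------------------------------------
  have hE₁' : L / 2 * |moebiusLogSum u - 1| ≤ C₁ * E₁ / L ^ n := by
    calc L / 2 * |moebiusLogSum u - 1| ≤ L / 2 * (C₁ * Real.exp (-(c₁ * Real.sqrt (Real.log u)))) :=
          mul_le_mul_of_nonneg_left hM₁u (by positivity)
      _ ≤ L / 2 * (C₁ * (E₁ / L ^ (n + 1))) := by
          gcongr
          exact (hexp hc₁ le_rfl).trans (hE₁ L hL1)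
      _ = C₁ * E₁ / L ^ n / 2 := by rw [pow_succ]; field_simp
      _ ≤ C₁ * E₁ / L ^ n := by
          have : 0 ≤ C₁ * E₁ / L ^ n := by positivity
          linarith
  have hEρ' : |moebiusLogSqSum u - 2 * (L / 2) - ρ| / 2 ≤ Cρ * Eρ / L ^ n := by
    calc |moebiusLogSqSum u - 2 * (L / 2) - ρ| / 2 ≤ Cρ * Real.exp (-(cρ * Real.sqrt (L / 2))) / 2 :=
          div_le_div_of_nonneg_right hρu (by norm_num)
      _ ≤ Cρ * (Eρ / L ^ n) / 2 := by gcongr; exact hEρ L hL1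
      _ ≤ Cρ * Eρ / L ^ n := by
          have h0 : 0 ≤ Cρ * (Eρ / L ^ n) := by positivity
          have h2 : Cρ * Eρ / L ^ n = Cρ * (Eρ / L ^ n) := by ring
          rw [h2]; linarith
  -- the identity behind the assembly
  have hid : -(∑ p ∈ Nat.primesLE J, Real.log p ^ 2 / p *
        ∑ m ∈ (Icc 1 (N / p)).filter (fun m ↦ m.Coprime p), (ArithmeticFunction.moebius m : ℝ) / m) -
      ((L / 2 * moebiusLogSum u + moebiusLogSqSum u / 2) +
        ∑ k ∈ Icc 1 J, (ArithmeticFunction.moebius k : ℝ) / k *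
          ((∑ p ∈ Nat.primesLE (N / k), Real.log p ^ 2 / p) - (∑ p ∈ Nat.primesLE J, Real.log p ^ 2 / p) -
            (Real.log (y / k) ^ 2 / 2 - Real.log u ^ 2 / 2))) + L - -(ρ / 2) =
      -(∑ p ∈ Nat.primesLE J, Real.log p ^ 2 / p *
        ∑ m ∈ (Icc 1 (N / p)).filter (fun m ↦ m.Coprime p), (ArithmeticFunction.moebius m : ℝ) / m) -
      ∑ k ∈ Icc 1 J, (ArithmeticFunction.moebius k : ℝ) / k *
          ((∑ p ∈ Nat.primesLE (N / k), Real.log p ^ 2 / p) - (∑ p ∈ Nat.primesLE J, Real.log p ^ 2 / p) -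
            (Real.log (y / k) ^ 2 / 2 - Real.log u ^ 2 / 2)) -
      L / 2 * (moebiusLogSum u - 1) - (moebiusLogSqSum u - 2 * (L / 2) - ρ) / 2 := by ring
  rw [hid]
  have hT3 : |L / 2 * (moebiusLogSum u - 1)| ≤ C₁ * E₁ / L ^ n := by
    rw [abs_mul, abs_of_nonneg (by positivity : 0 ≤ L / 2)]; exact hE₁'
  have hT4 : |(moebiusLogSqSum u - 2 * (L / 2) - ρ) / 2| ≤ Cρ * Eρ / L ^ n := by
    rw [abs_div, abs_of_pos (by norm_num : (0:ℝ) < 2)]; exact hEρ'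
  calc _ ≤ |-(∑ p ∈ Nat.primesLE J, Real.log p ^ 2 / p *
        ∑ m ∈ (Icc 1 (N / p)).filter (fun m ↦ m.Coprime p), (ArithmeticFunction.moebius m : ℝ) / m)| +
      |∑ k ∈ Icc 1 J, (ArithmeticFunction.moebius k : ℝ) / k *
          ((∑ p ∈ Nat.primesLE (N / k), Real.log p ^ 2 / p) - (∑ p ∈ Nat.primesLE J, Real.log p ^ 2 / p) -
            (Real.log (y / k) ^ 2 / 2 - Real.log u ^ 2 / 2))| +
      |L / 2 * (moebiusLogSum u - 1)| + |(moebiusLogSqSum u - 2 * (L / 2) - ρ) / 2| := by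
        refine (abs_sub _ _).trans (add_le_add ((abs_sub _ _).trans (add_le_add (abs_sub _ _) le_rfl)) le_rfl)
    _ ≤ 2 * CG * EG / L ^ n + 2 ^ (n + 4) * K₂ / L ^ n + C₁ * E₁ / L ^ n + Cρ * Eρ / L ^ n :=
        add_le_add (add_le_add (add_le_add (by rw [abs_neg]; exact hA) hBerr) hT3) hT4
    _ = (2 * CG * EG + 2 ^ (n + 4) * K₂ + C₁ * E₁ + Cρ * Eρ) / L ^ n := by ring

end Summit.Parity.GeneralizedHardyLittlewood.Theorems.MomentsBeyondDiagonal.DiagCorner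

end
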